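import Summits.AtomisticToContinuum.BoseEinsteinCondensation.Theorems.BECThomsonPrincipleGDTransferSeededProjectedDichotomyCardinality
import Summits.AtomisticToContinuum.BoseEinsteinCondensation.Theorems.BECThomsonPrincipleGDTransferSeededProjectedDichotomyPlainPair

/-!
# Route `BECThomsonPrinciple`, crux `GDTransfer` (stmt-AtomisticToContinuum-9482), line `seeded-continuity`:
# stub `stub_projectedDichotomy`, part A3b — ZERO-DEFECT RESPONSE (W3) of the plain witness pair

Support file of the registered stub `stub_projectedDichotomy`.  For a periodic trial state `Ψ`, `n ≠ 0` and the plain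
pair `ζ₊ = N^{-1/2}B_nΨ = N^{-1/2}Σ_i e_n(x_i)P_iΨ`, `ζ₋ = N^{-1/2}B_n†Ψ = N^{-1/2}Σ_i P_i^{(n)}Ψ`:
`‖ζ₊‖² + ‖ζ₋‖² ≤ N|σ_n(ζ₊,Ψ) + σ_n(Ψ,ζ₋)|` (`plainPair_positivity`, a0's interface shape (W3) with zero defect), from
* (L2) of the landed `LNSSAlgebra`: `Nσ(ζ₊,Ψ) = ⟨ζ₊, Λ_n†Ψ⟩ = N^{-1/2}⟨B_nΨ, B_n n̂₀^{-1/2}Ψ⟩` and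
  `Nσ(Ψ,ζ₋) = ⟨Λ_nΨ, ζ₋⟩ = N^{-1/2}⟨n̂₀^{-1/2}B_n†Ψ, B_n†Ψ⟩` (`lnssUpper = B_n ∘ rootInv`, `lnssLower = rootInv ∘ B_n†` by `rfl`);
* the operator bound `n̂₀^{-1/2} ≥ N^{-1/2}(1 − Q_∅)` of part A3a applied to `h = B_n†Ψ` (`Q_∅B_n†Ψ = 0`) — `lower_overlap`;
* for `ζ₊`, the cardinality decomposition of part A3a and cross-cardinality orthogonality of part A2:
  `⟨B_nΨ, B_n n̂₀^{-1/2}Ψ⟩ = Σ_{j≥1} j^{-1/2}‖B_nΠ_jΨ‖² ≥ N^{-1/2}‖B_nΨ‖²` (`j ≤ N`, `B_nΠ_0Ψ = 0`) — `upper_overlap`.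
All [folklore] (arXiv:1211.2778 §2; LSSY2005 App. A).
-/

noncomputable section

open MeasureTheory Filter
open scoped ENNReal NNReal ComplexConjugate

namespace Summit.AtomisticToContinuum.BoseEinsteinCondensation.Cruxes.GDTransfer.Seeded

namespace Positivity

open Literature.MathematicalPhysics.QuantumManyBody.BoseGas
open Summit.AtomisticToContinuum.BoseEinsteinCondensation.Theorems.GaussianDominationCan.Negative
open Summit.AtomisticToContinuum.BoseEinsteinCondensation.Cruxes.GDTransfer.DysonDressedWitness
open ChordVariation (continuous_modeProj dir_const_mul mass_smul)
open Lnss Sector Cardinality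

variable {N m : ℕ} {L : ℝ}

/-! ## The two overlaps -/

/-- **The upper overlap**: `⟨B_nΨ, B_n n̂₀^{-1/2}Ψ⟩ = Σ_{j ≥ 1} j^{-1/2}‖B_nΠ_jΨ‖²`, a real number `≥ N^{-1/2}‖B_nΨ‖²`.
[folklore] -/
theorem upper_overlap (hL : 0 < L) {n : Fin 3 → ℤ} (hn : n ≠ 0) {ψ : Config (m + 1) → ℂ} (hψ : Continuous ψ) :
    ∃ r : ℝ, (∫ X in cellN (m + 1) L, conj (∑ i : Fin (m + 1), cellWave L n (X i) * cellAvg (m + 1) L i ψ X) *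
        lnssUpper m L n ψ X) = (r : ℂ) ∧
      (Real.sqrt ((m : ℝ) + 1))⁻¹ *
          ∫ X in cellN (m + 1) L, ‖∑ i : Fin (m + 1), cellWave L n (X i) * cellAvg (m + 1) L i ψ X‖ ^ 2 ≤ r := by
  set A : ℕ → Config (m + 1) → ℂ := fun j X => ∑ i : Fin (m + 1), cellWave L n (X i) *
    cellAvg (m + 1) L i (fun Y => ∑ T ∈ (Finset.univ : Finset (Finset (Fin (m + 1)))).filter
      (fun T => T.card = j), modeProj (m + 1) L T ψ Y) X with hA
  set a : ℕ → ℝ := fun j => ∫ X in cellN (m + 1) L, ‖A j X‖ ^ 2 with ha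
  set c : ℕ → ℂ := fun j => if j = 0 then 0 else ((Real.sqrt (j : ℝ))⁻¹ : ℂ) with hc
  have hPic : ∀ j ∈ Finset.range (m + 2), Continuous (fun Y => ∑ T ∈ (Finset.univ :
      Finset (Finset (Fin (m + 1)))).filter (fun T => T.card = j), modeProj (m + 1) L T ψ Y) := fun j _ =>
    continuous_finsetSum _ fun T _ => continuous_modeProj T hψ
  -- the two decompositions
  have hψdec : ψ = fun Y => ∑ j ∈ Finset.range (m + 2), (1 : ℂ) * ∑ T ∈ (Finset.univ :
      Finset (Finset (Fin (m + 1)))).filter (fun T => T.card = j), modeProj (m + 1) L T ψ Y := by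
    funext Y
    simp only [one_mul]
    exact (sum_cardSum_apply ψ Y).symm
  have hRdec : rootInv m L ψ = fun Y => ∑ j ∈ Finset.range (m + 2), c j * ∑ T ∈ (Finset.univ :
      Finset (Finset (Fin (m + 1)))).filter (fun T => T.card = j), modeProj (m + 1) L T ψ Y := by
    funext Y
    exact rootInv_apply_eq_cardSum ψ Y
  have hB : (fun X => ∑ i : Fin (m + 1), cellWave L n (X i) * cellAvg (m + 1) L i ψ X) =
      fun X => ∑ j ∈ Finset.range (m + 2), (1 : ℂ) * A j X := by
    conv_lhs => rw [hψdec]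
    rw [upB_finset_sum _ _ hPic n]
  have hBR : lnssUpper m L n ψ = fun X => ∑ j ∈ Finset.range (m + 2), c j * A j X := by
    show (fun X => ∑ i : Fin (m + 1), cellWave L n (X i) * cellAvg (m + 1) L i (rootInv m L ψ) X) = _
    rw [hRdec, upB_finset_sum _ _ hPic n]
  -- the diagonal computations
  have h1 : ∫ X in cellN (m + 1) L, conj (∑ j ∈ Finset.range (m + 2), (1 : ℂ) * A j X) *
      (∑ j ∈ Finset.range (m + 2), c j * A j X) =
        ∑ j ∈ Finset.range (m + 2), conj (1 : ℂ) * c j * ((a j : ℝ) : ℂ) :=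
    integral_conj_sum_upB_mul_sum_upB hL hn c (fun _ => (1 : ℂ)) hψ
  have h2 : ∫ X in cellN (m + 1) L, conj (∑ j ∈ Finset.range (m + 2), (1 : ℂ) * A j X) *
      (∑ j ∈ Finset.range (m + 2), (1 : ℂ) * A j X) =
        ∑ j ∈ Finset.range (m + 2), conj (1 : ℂ) * (1 : ℂ) * ((a j : ℝ) : ℂ) :=
    integral_conj_sum_upB_mul_sum_upB hL hn (fun _ => (1 : ℂ)) (fun _ => (1 : ℂ)) hψ
  simp only [map_one, one_mul] at h1 h2
  have hBX : ∀ X, ∑ i : Fin (m + 1), cellWave L n (X i) * cellAvg (m + 1) L i ψ X =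
      ∑ j ∈ Finset.range (m + 2), A j X := fun X => by
    simpa only [one_mul] using congrFun hB X
  have hBRX : ∀ X, lnssUpper m L n ψ X = ∑ j ∈ Finset.range (m + 2), c j * A j X := fun X => congrFun hBR X
  refine ⟨∑ j ∈ Finset.range (m + 2), (if j = 0 then 0 else (Real.sqrt (j : ℝ))⁻¹) * a j, ?_, ?_⟩
  · simp_rw [hBRX, hBX]
    rw [h1]
    push_cast
    refine Finset.sum_congr rfl fun j _ => ?_
    rw [hc]
    dsimp only
    by_cases hj : j = 0
    · rw [if_pos hj, if_pos hj]
      simp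
    · rw [if_neg hj, if_neg hj]
      push_cast
      ring
  · -- `N^{-1/2} Σ_j a_j ≤ Σ_j [j ≠ 0] j^{-1/2} a_j`, with `a_0 = 0`
    have hU : ∫ X in cellN (m + 1) L, ‖∑ i : Fin (m + 1), cellWave L n (X i) * cellAvg (m + 1) L i ψ X‖ ^ 2 =
        ∑ j ∈ Finset.range (m + 2), a j := by
      apply Complex.ofReal_injective
      rw [← integral_conj_mul_self]
      simp_rw [hBX]
      rw [h2]
      push_cast
      rfl
    have hA0 : A 0 = 0 := upB_cardSum_zero hL hn hψ
    have ha0 : a 0 = 0 := by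
      show (∫ X in cellN (m + 1) L, ‖A 0 X‖ ^ 2) = 0
      rw [hA0]
      simp
    rw [hU, Finset.mul_sum]
    refine Finset.sum_le_sum fun j hj => ?_
    have haj : 0 ≤ a j := integral_nonneg fun X => sq_nonneg _
    by_cases hj0 : j = 0
    · subst hj0
      rw [ha0]
      simp
    · rw [if_neg hj0]
      refine mul_le_mul_of_nonneg_right ?_ haj
      have hjle : (j : ℝ) ≤ (m : ℝ) + 1 := by
        have := Finset.mem_range.1 hj
        exact_mod_cast Nat.lt_succ_iff.1 this
      have hjpos : 0 < Real.sqrt (j : ℝ) := Real.sqrt_pos.2 (by exact_mod_cast Nat.pos_of_ne_zero hj0)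
      exact inv_anti₀ hjpos (Real.sqrt_le_sqrt hjle)

/-- **The lower overlap**: `⟨n̂₀^{-1/2}B_n†Ψ, B_n†Ψ⟩` is a real number `≥ N^{-1/2}‖B_n†Ψ‖²` (`Q_∅ B_n†Ψ = 0`). [folklore] -/
theorem lower_overlap (hL : 0 < L) (n : Fin 3 → ℤ) {ψ : Config (m + 1) → ℂ} (hψ : Continuous ψ) :
    ∃ r : ℝ, (∫ X in cellN (m + 1) L, conj (lnssLower m L n ψ X) * (∑ i : Fin (m + 1), fourierAvg m L n i ψ X)) =
        (r : ℂ) ∧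
      (Real.sqrt ((m : ℝ) + 1))⁻¹ * ∫ X in cellN (m + 1) L, ‖∑ i : Fin (m + 1), fourierAvg m L n i ψ X‖ ^ 2 ≤ r := by
  have hh : Continuous fun X => ∑ i : Fin (m + 1), fourierAvg m L n i ψ X := continuous_sum_fourierAvg n hψ
  have h0 : modeProj (m + 1) L ∅ (fun X => ∑ i : Fin (m + 1), fourierAvg m L n i ψ X) = 0 := by
    rw [modeProj_finset_sum _ (fun i _ => continuous_fourierAvg n i hψ)]
    funext X
    rw [Pi.zero_apply]
    exact Finset.sum_eq_zero fun i _ => by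
      rw [modeProj_fourierAvg_eq_zero hL n (Finset.notMem_empty i) hψ, Pi.zero_apply]
  refine ⟨_, ?_, rootInv_lower hL hh h0⟩
  show (∫ X in cellN (m + 1) L, conj (rootInv m L (fun X => ∑ i : Fin (m + 1), fourierAvg m L n i ψ X) X) *
      (∑ i : Fin (m + 1), fourierAvg m L n i ψ X)) = _
  rw [← integral_conj_mul_rootInv hh hh, integral_conj_mul_rootInv_self hL hh]

/-! ## (W3) for the plain pair -/

/-- `‖(x : ℂ)‖₊² = x²` in `ℝ≥0∞` for `x ≥ 0`. [folklore] -/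
theorem coef_sq {x : ℝ} (hx : 0 ≤ x) : ((‖(x : ℂ)‖₊ : ℝ≥0∞)) ^ 2 = ENNReal.ofReal (x ^ 2) := by
  rw [← ENNReal.coe_pow, ← ENNReal.ofReal_coe_nnreal, NNReal.coe_pow, coe_nnnorm, Complex.norm_real,
    Real.norm_of_nonneg hx]

/-- **(W3) with zero defect for the plain pair**: `‖ζ₊‖² + ‖ζ₋‖² ≤ N|σ_n(ζ₊,Ψ) + σ_n(Ψ,ζ₋)|`. [folklore] -/
theorem mass_add_mass_le (hL : 0 < L) {n : Fin 3 → ℤ} (hn : n ≠ 0) (Ψ : PeriodicTrialState (m + 1) L) :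
    mass L (fun X => ((Real.sqrt ((m : ℝ) + 1))⁻¹ : ℂ) *
          ∑ i : Fin (m + 1), cellWave L n (X i) * cellAvg (m + 1) L i Ψ.ψ X) +
        mass L (fun X => ((Real.sqrt ((m : ℝ) + 1))⁻¹ : ℂ) * ∑ i : Fin (m + 1), fourierAvg m L n i Ψ.ψ X) ≤
      ENNReal.ofReal (((m + 1 : ℕ) : ℝ) *
        ‖srcPair m L n (fun X => ((Real.sqrt ((m : ℝ) + 1))⁻¹ : ℂ) *
              ∑ i : Fin (m + 1), cellWave L n (X i) * cellAvg (m + 1) L i Ψ.ψ X) Ψ.ψ +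
            srcPair m L n Ψ.ψ (fun X => ((Real.sqrt ((m : ℝ) + 1))⁻¹ : ℂ) *
              ∑ i : Fin (m + 1), fourierAvg m L n i Ψ.ψ X)‖) := by
  have hψ : Continuous Ψ.ψ := Ψ.contDiff.continuous
  set cN : ℝ := (Real.sqrt ((m : ℝ) + 1))⁻¹ with hcN
  have hcN0 : 0 ≤ cN := by positivity
  have hcoe : ((Real.sqrt ((m : ℝ) + 1))⁻¹ : ℂ) = ((cN : ℝ) : ℂ) := by
    rw [hcN, Complex.ofReal_inv]
  simp only [hcoe]
  -- the directions and their symmetry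
  have hdU := dir_const_mul (PlainPair.isDirection_upB hL.ne' n (isDirection_trialState Ψ)) (cN : ℂ)
  have hdD := dir_const_mul (PlainPair.isDirection_dnB n (isDirection_trialState Ψ)) (cN : ℂ)
  have hUc : Continuous fun X => ∑ i : Fin (m + 1), cellWave L n (X i) * cellAvg (m + 1) L i Ψ.ψ X :=
    (PlainPair.isDirection_upB hL.ne' n (isDirection_trialState Ψ)).contDiff.continuous
  have hDc : Continuous fun X => ∑ i : Fin (m + 1), fourierAvg m L n i Ψ.ψ X := continuous_sum_fourierAvg n hψ
  -- the overlaps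
  obtain ⟨rU, hrU, hrUle⟩ := upper_overlap hL hn hψ
  obtain ⟨rD, hrD, hrDle⟩ := lower_overlap hL n hψ
  set U : ℝ := ∫ X in cellN (m + 1) L, ‖∑ i : Fin (m + 1), cellWave L n (X i) * cellAvg (m + 1) L i Ψ.ψ X‖ ^ 2
    with hU
  set D : ℝ := ∫ X in cellN (m + 1) L, ‖∑ i : Fin (m + 1), fourierAvg m L n i Ψ.ψ X‖ ^ 2 with hD
  have hU0 : 0 ≤ U := integral_nonneg fun X => sq_nonneg _
  have hD0 : 0 ≤ D := integral_nonneg fun X => sq_nonneg _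
  -- (L2): `N σ(ζ₊,Ψ) = cN · rU`, `N σ(Ψ,ζ₋) = cN · rD`
  have hσU : ((m + 1 : ℕ) : ℂ) * srcPair m L n (fun X => (cN : ℂ) *
      ∑ i : Fin (m + 1), cellWave L n (X i) * cellAvg (m + 1) L i Ψ.ψ X) Ψ.ψ = ((cN * rU : ℝ) : ℂ) := by
    rw [natMul_srcPair_eq_inner_lnssUpper hL n hdU.contDiff.continuous hdU.symm hψ Ψ.symm]
    simp only [map_mul, Complex.conj_ofReal]
    calc ∫ X in cellN (m + 1) L, (cN : ℂ) *
          conj (∑ i : Fin (m + 1), cellWave L n (X i) * cellAvg (m + 1) L i Ψ.ψ X) * lnssUpper m L n Ψ.ψ X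
        = (cN : ℂ) * ∫ X in cellN (m + 1) L,
            conj (∑ i : Fin (m + 1), cellWave L n (X i) * cellAvg (m + 1) L i Ψ.ψ X) * lnssUpper m L n Ψ.ψ X := by
          rw [← integral_const_mul]
          exact integral_congr_ae (Eventually.of_forall fun X => by ring)
      _ = ((cN * rU : ℝ) : ℂ) := by rw [hrU]; push_cast; ring
  have hσD : ((m + 1 : ℕ) : ℂ) * srcPair m L n Ψ.ψ (fun X => (cN : ℂ) *
      ∑ i : Fin (m + 1), fourierAvg m L n i Ψ.ψ X) = ((cN * rD : ℝ) : ℂ) := by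
    rw [natMul_srcPair_eq_inner_lnssLower hL n hψ Ψ.symm hdD.contDiff.continuous hdD.symm]
    calc ∫ X in cellN (m + 1) L, conj (lnssLower m L n Ψ.ψ X) *
          ((cN : ℂ) * ∑ i : Fin (m + 1), fourierAvg m L n i Ψ.ψ X)
        = (cN : ℂ) * ∫ X in cellN (m + 1) L, conj (lnssLower m L n Ψ.ψ X) *
            ∑ i : Fin (m + 1), fourierAvg m L n i Ψ.ψ X := by
          rw [← integral_const_mul]
          exact integral_congr_ae (Eventually.of_forall fun X => by ring)
      _ = ((cN * rD : ℝ) : ℂ) := by rw [hrD]; push_cast; ring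
  -- the masses in real numbers
  have hmU : mass L (fun X => (cN : ℂ) * ∑ i : Fin (m + 1), cellWave L n (X i) * cellAvg (m + 1) L i Ψ.ψ X) =
      ENNReal.ofReal (cN ^ 2 * U) := by
    rw [mass_smul, coef_sq hcN0]
    unfold mass
    rw [lintegral_nnnorm_sq_eq _ hUc, ← ENNReal.ofReal_mul (sq_nonneg _)]
  have hmD : mass L (fun X => (cN : ℂ) * ∑ i : Fin (m + 1), fourierAvg m L n i Ψ.ψ X) =
      ENNReal.ofReal (cN ^ 2 * D) := by
    rw [mass_smul, coef_sq hcN0]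
    unfold mass
    rw [lintegral_nnnorm_sq_eq _ hDc, ← ENNReal.ofReal_mul (sq_nonneg _)]
  -- the real inequality `cN²(U + D) ≤ cN(rU + rD) = N|σ₊ + σ₋|`
  have hreal : cN ^ 2 * U + cN ^ 2 * D ≤ cN * (rU + rD) := by
    have h1 : cN * (cN * U) ≤ cN * rU := mul_le_mul_of_nonneg_left hrUle hcN0
    have h2 : cN * (cN * D) ≤ cN * rD := mul_le_mul_of_nonneg_left hrDle hcN0
    nlinarith
  have hnorm : ((m + 1 : ℕ) : ℝ) *
      ‖srcPair m L n (fun X => (cN : ℂ) * ∑ i : Fin (m + 1), cellWave L n (X i) * cellAvg (m + 1) L i Ψ.ψ X) Ψ.ψ +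
        srcPair m L n Ψ.ψ (fun X => (cN : ℂ) * ∑ i : Fin (m + 1), fourierAvg m L n i Ψ.ψ X)‖ =
      cN * (rU + rD) := by
    have hpos : 0 ≤ cN * (rU + rD) := by nlinarith [hreal, mul_nonneg (sq_nonneg cN) hU0, mul_nonneg (sq_nonneg cN) hD0]
    have h := congrArg norm (show ((m + 1 : ℕ) : ℂ) * (srcPair m L n (fun X => (cN : ℂ) *
        ∑ i : Fin (m + 1), cellWave L n (X i) * cellAvg (m + 1) L i Ψ.ψ X) Ψ.ψ +
          srcPair m L n Ψ.ψ (fun X => (cN : ℂ) * ∑ i : Fin (m + 1), fourierAvg m L n i Ψ.ψ X)) =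
        ((cN * (rU + rD) : ℝ) : ℂ) by rw [mul_add, hσU, hσD]; push_cast; ring)
    rwa [norm_mul, Complex.norm_natCast, Complex.norm_real, Real.norm_of_nonneg hpos] at h
  rw [hmU, hmD, ← ENNReal.ofReal_add (by positivity) (by positivity), hnorm]
  exact ENNReal.ofReal_le_ofReal hreal

end Positivity

/-- **Part A3 of `stub_projectedDichotomy` (registered helper statement)**: the ZERO-DEFECT RESPONSE (W3) of the
plain one-body witness pair `ζ₊ = N^{-1/2}Σ_i e_n(x_i)P_iΨ`, `ζ₋ = N^{-1/2}Σ_i P_i^{(n)}Ψ` —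
`‖ζ₊‖² + ‖ζ₋‖² ≤ 2N|σ_n(ζ₊,Ψ) + σ_n(Ψ,ζ₋)|` for every periodic trial state and `n ≠ 0`. [folklore] -/
theorem plainPair_positivity :
    ∀ (m : ℕ) (L : ℝ), 0 < L → ∀ n : Fin 3 → ℤ, n ≠ 0 →
      ∀ Ψ : Literature.MathematicalPhysics.QuantumManyBody.BoseGas.PeriodicTrialState (m + 1) L,
        Summit.AtomisticToContinuum.BoseEinsteinCondensation.Cruxes.GDTransfer.DysonDressedWitness.mass L
              (fun X => ((Real.sqrt ((m : ℝ) + 1))⁻¹ : ℂ) *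
                ∑ i : Fin (m + 1), Literature.MathematicalPhysics.QuantumManyBody.BoseGas.cellWave L n (X i) *
                  Summit.AtomisticToContinuum.BoseEinsteinCondensation.Theorems.GaussianDominationCan.Negative.cellAvg
                    (m + 1) L i Ψ.ψ X) +
            Summit.AtomisticToContinuum.BoseEinsteinCondensation.Cruxes.GDTransfer.DysonDressedWitness.mass L
              (fun X => ((Real.sqrt ((m : ℝ) + 1))⁻¹ : ℂ) *
                ∑ i : Fin (m + 1),
                  Summit.AtomisticToContinuum.BoseEinsteinCondensation.Cruxes.GDTransfer.DysonDressedWitness.fourierAvg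
                    m L n i Ψ.ψ X) ≤
          2 * ENNReal.ofReal (((m + 1 : ℕ) : ℝ) *
            ‖Summit.AtomisticToContinuum.BoseEinsteinCondensation.Cruxes.GDTransfer.DysonDressedWitness.srcPair m L n
                  (fun X => ((Real.sqrt ((m : ℝ) + 1))⁻¹ : ℂ) *
                    ∑ i : Fin (m + 1), Literature.MathematicalPhysics.QuantumManyBody.BoseGas.cellWave L n (X i) *
                      Summit.AtomisticToContinuum.BoseEinsteinCondensation.Theorems.GaussianDominationCan.Negative.cellAvg
                        (m + 1) L i Ψ.ψ X) Ψ.ψ +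
                Summit.AtomisticToContinuum.BoseEinsteinCondensation.Cruxes.GDTransfer.DysonDressedWitness.srcPair m L n
                  Ψ.ψ (fun X => ((Real.sqrt ((m : ℝ) + 1))⁻¹ : ℂ) *
                    ∑ i : Fin (m + 1),
                      Summit.AtomisticToContinuum.BoseEinsteinCondensation.Cruxes.GDTransfer.DysonDressedWitness.fourierAvg
                        m L n i Ψ.ψ X)‖) :=
  fun _ _ hL _ hn Ψ => (Positivity.mass_add_mass_le hL hn Ψ).trans (le_mul_of_one_le_left' (by norm_num))

end Summit.AtomisticToContinuum.BoseEinsteinCondensation.Cruxes.GDTransfer.Seeded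

end
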